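import Summits.CriticalPhenomena.PercolationContinuityZ3.Theorems.PercLowPointHalfSpaceTallClusterMassBoundWallArmPartial

/-!
# `TallClusterMassBound` (stmt-CriticalPhenomena-0912), line `replica-overlap-cs-transfer` —
# the wall-arm doubling ratio exceeds `1/4 − ε` infinitely often

Context. The registered stub `stub_wallArmLowerRegularity` (two-scale lower regularity of the wall one-arm
`π_s(n) = armProb (criticalProbI 3) n` with exponent `< 11/4`) follows from a UNIFORM doubling bound
`π_s(2n) ≥ q₀ π_s(n)` for all large `n` with `q₀ > 2^{-11/4} ≈ 0.1487` (skeleton lemma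
`wallArmLowerRegularity_of_doubling`); that uniform bound is open in `d = 3` (no gluing). This file proves the
one-sided rigorous fact available today: the doubling ratio cannot stay below `1/4 − ε` from some scale on.
Indeed `π_s(2^k n₀) ≤ q^k π_s(n₀) ≤ q^k` would contradict the one-scale lower bound
`π_s(m) ≥ 1/(588 m²)` (`armProb_criticalProbI_ge` of the landed helper file `…WallArmPartial`, i.e.
`armH_lower_bound`: DCT `φ_{p_c}(Λ_m) ≥ 1` + face isomorphisms) as soon as `4q < 1`.
Since `1/4 > 2^{-11/4}`, the stub can only fail through sporadic bad scales, never through an eventually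
uniform deficit — information for whoever files/attacks the doubling statement.

* `armProb_two_mul_pow_le` : iterating an eventual upper doubling bound, `π_s(2^k n) ≤ q^k π_s(n)`.
* `doubling_ratio_ge_io` : `∀ q < 1/4, ∀ n₀, ∃ n ≥ n₀, q · π_s(n) < π_s(2n)` at `p_c(ℤ³)` (registered form:
  `wallArm_doubling_ge_quarter_io`).
-/

noncomputable section

open MeasureTheory Finset Filter
open Literature.Probability.Percolation Literature.Probability.LatticeModels
open Summit.CriticalPhenomena.PercolationContinuityZ3.Theorems.TallClusterMassBound.Negative
open Summit.CriticalPhenomena.PercolationContinuityZ3.Theorems.QuantitativeBGN.Negative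

namespace Summit.CriticalPhenomena.PercolationContinuityZ3.Theorems.TallClusterMassBound.ReplicaOverlap

/-- Iterating an eventual UPPER doubling bound: if `π_s(2n) ≤ q π_s(n)` for all `n ≥ n₀` (`q ≥ 0`), then
`π_s(2^k n) ≤ q^k π_s(n)` for all `k` and `n ≥ n₀`. [folklore] -/
theorem armProb_two_mul_pow_le {p : unitInterval} {q : ℝ} (hq : 0 ≤ q) {n₀ : ℕ}
    (h : ∀ n : ℕ, n₀ ≤ n → armProb p (2 * n) ≤ q * armProb p n) :
    ∀ k n : ℕ, n₀ ≤ n → armProb p (2 ^ k * n) ≤ q ^ k * armProb p n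
  | 0, n, _ => by simp
  | k + 1, n, hn => by
    have ih := armProb_two_mul_pow_le hq h k n hn
    have hle : n₀ ≤ 2 ^ k * n := le_trans hn (Nat.le_mul_of_pos_left n (pow_pos (by norm_num) k))
    calc armProb p (2 ^ (k + 1) * n) = armProb p (2 * (2 ^ k * n)) := by rw [pow_succ]; ring_nf
      _ ≤ q * armProb p (2 ^ k * n) := h _ hle
      _ ≤ q * (q ^ k * armProb p n) := mul_le_mul_of_nonneg_left ih hq
      _ = q ^ (k + 1) * armProb p n := by ring

/-- **The doubling ratio is `≥ q` infinitely often, for every `q < 1/4`**: at `p_c(ℤ³)`, for every `n₀` there is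
`n ≥ n₀` with `q π_s(n) < π_s(2n)`. Otherwise `π_s(2^k n₁) ≤ q^k` for all `k` (`n₁ = max n₀ 1`), while
`π_s(2^k n₁) ≥ 1/(588 (2^k n₁)²)`, i.e. `1 ≤ 588 n₁² (4q)^k` for all `k` — impossible since `0 ≤ 4q < 1`.
[folklore] -/
theorem doubling_ratio_ge_io {q : ℝ} (hq : q < 1 / 4) (n₀ : ℕ) :
    ∃ n : ℕ, n₀ ≤ n ∧ q * armProb (criticalProbI 3) n < armProb (criticalProbI 3) (2 * n) := by
  by_contra hcon
  push Not at hcon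
  -- WLOG q ≥ 0 (for q < 0 the claim is immediate from positivity)
  rcases lt_or_ge q 0 with hqneg | hq0
  · have h := hcon n₀ le_rfl
    have hpos := armProb_criticalProbI_pos (2 * n₀)
    have hnn := armProb_nonneg (criticalProbI 3) n₀
    nlinarith
  set n₁ : ℕ := max n₀ 1 with hn₁
  have hn₁1 : 1 ≤ n₁ := le_max_right _ _
  have hn₁0 : n₀ ≤ n₁ := le_max_left _ _
  have hiter := armProb_two_mul_pow_le (p := criticalProbI 3) hq0 (n₀ := n₁)
    (fun n hn => hcon n (hn₁0.trans hn))
  -- the quantity 588 n₁² (4q)^k tends to 0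
  have h4q0 : 0 ≤ 4 * q := by linarith
  have h4q1 : 4 * q < 1 := by linarith
  have htend : Tendsto (fun k : ℕ => 588 * (n₁ : ℝ) ^ 2 * (4 * q) ^ k) atTop (nhds 0) := by
    have := (tendsto_pow_atTop_nhds_zero_of_lt_one h4q0 h4q1).const_mul (588 * (n₁ : ℝ) ^ 2)
    simpa using this
  obtain ⟨k, hk⟩ := ((htend.eventually (gt_mem_nhds (show (0 : ℝ) < 1 by norm_num))).and
    (eventually_ge_atTop 0)).exists
  have hk1 : 588 * (n₁ : ℝ) ^ 2 * (4 * q) ^ k < 1 := hk.1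
  -- lower bound at scale 2^k n₁
  have hm : 1 ≤ 2 ^ k * n₁ := le_trans hn₁1 (Nat.le_mul_of_pos_left n₁ (pow_pos (by norm_num) k))
  have hlow := armProb_criticalProbI_ge hm
  have hup := hiter k n₁ le_rfl
  have hπ1 : armProb (criticalProbI 3) n₁ ≤ 1 := armProb_le_one _ _
  have hqk : 0 ≤ q ^ k := pow_nonneg hq0 k
  have hup' : armProb (criticalProbI 3) (2 ^ k * n₁) ≤ q ^ k := by
    calc armProb (criticalProbI 3) (2 ^ k * n₁) ≤ q ^ k * armProb (criticalProbI 3) n₁ := hup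
      _ ≤ q ^ k * 1 := mul_le_mul_of_nonneg_left hπ1 hqk
      _ = q ^ k := mul_one _
  -- combine: 1/(588 (2^k n₁)²) ≤ q^k, i.e. 1 ≤ 588 n₁² (4q)^k
  have hcast : ((2 ^ k * n₁ : ℕ) : ℝ) = (2 : ℝ) ^ k * n₁ := by push_cast; ring
  rw [hcast] at hlow
  have hn1r : (1 : ℝ) ≤ n₁ := by exact_mod_cast hn₁1
  have hpos : (0 : ℝ) < 588 * ((2 : ℝ) ^ k * n₁) ^ 2 := by positivity
  have hcomb : 1 / (588 * ((2 : ℝ) ^ k * n₁) ^ 2) ≤ q ^ k := hlow.trans hup'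
  rw [div_le_iff₀ hpos] at hcomb
  have hid : q ^ k * (588 * ((2 : ℝ) ^ k * n₁) ^ 2) = 588 * (n₁ : ℝ) ^ 2 * (4 * q) ^ k := by
    rw [mul_pow, mul_pow, ← pow_mul, show (2 : ℝ) ^ (k * 2) = 4 ^ k by
      rw [mul_comm, pow_mul]; norm_num]
    ring
  rw [hid] at hcomb
  linarith

/-- **Registered form** (binder-free): for every `q < 1/4` and every `n₀` there is `n ≥ n₀` with
`q · π_s(n) < π_s(2n)` at `p_c(ℤ³)`; in particular the doubling ratio exceeds the threshold `2^{-11/4} < 1/4` of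
`wallArmLowerRegularity_of_doubling` infinitely often. [folklore] -/
theorem wallArm_doubling_ge_quarter_io :
    ∀ (q : ℝ), q < 1 / 4 → ∀ n₀ : ℕ, ∃ n : ℕ, n₀ ≤ n ∧
      q * armProb (criticalProbI 3) n < armProb (criticalProbI 3) (2 * n) :=
  fun _ hq n₀ => doubling_ratio_ge_io hq n₀

end Summit.CriticalPhenomena.PercolationContinuityZ3.Theorems.TallClusterMassBound.ReplicaOverlap
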